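import Summits.ResolutionOfSingularities.ResolutionOfSingularities.Theorems.PurelyInseparableDim4ResConeRowLemmaChain
import HarnessLib
import HarnessLib.Audit.Tags

/-!
# Purely inseparable four-folds — the ROW LEMMA (RL) IN COEFFICIENT-LAW FORM: three polynomials, the two steps
# entering only as coefficient laws off the `q`-th-power lattice (K2(p) lane, brick K29a, frame-ready dress;
# cell `res-dim4-pi`)

[OURS · counted 0 · cell `res-dim4-pi` · K2(p) lane (desk WORD #155; holder res-dim4-p-12 lineage), brick K29a
«ResConeContactSurfaceRows»: kernel res-dim4-p-9 g3 `…ResConeRowLemma` (p693699), chain dress res-dim4-p-9 g4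
`…ResConeRowLemmaChain` (p697572); the lemma res-dim4-idea-4 g4 (CONTACT-SURFACE.md §9); the three-polynomial
discipline res-dim4-p-5 g4 (`…LossyTiltFreeLegality`, brick (ii) `…ResConeFrameConjugation`); seat res-dim4-p-9 g4.]
Nothing here proves K2(p)/K2(5), `NoIsolatedTrap p p` or resolution of singularities in dimension ≥ 4 /
characteristic `p`.  AI kernel work, weaker than expert review.

`…ResConeRowLemmaChain` dressed (RL) on two literal `CentreBlowup.step`s.  res-dim4-p-5 g4's brick (ii) reads tilted
tails in MOVING FRAMES, where the parent/child/grandchild are related not by `step` but by the same COEFFICIENT LAWS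
off the `q`-th-power lattice (`…ResConeFrameConjugation.coeff_step_frame`: the straightened child versus the
re-coordinatised parent).  This file restates the two K29a theorems with the steps replaced by those laws, so that
(RL) applies verbatim to re-coordinatised states and to every future general-`(p, d)` lossy pair:
* §1 **`coeff_eq_zero_of_pair_laws`** — (RL-b) transport for THREE POLYNOMIALS `F₀, F₁, F₂`: laws `hS1` (chart `a`,
  from `F₀` to `F₁`), `hS2` (chart `a′`, from `F₁` to `F₂`) off the lattice, `F₁` of order `≥ q`, every monomial of
  `F₂` of degree `≥ o₂` and those of degree `o₂` with `x_a`-exponent `A`; then a monomial `x^E` of `F₀` with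
  `|E| > A + q`, off the coset, and `2|E| + E_{a′} + 2|E|_inert ≤ o₂ + 3q` is absent;
* §2 **`row_eq_zero_of_pair_laws`** — (RL) for `F₀ = shear_a^{t e_{a′}} (x_a^α x_{a′}^β · G)`, `t ≠ 0`, with the
  numerology `A + q = α + β + d`, `o₂ + 3q = 2(α + β) + 4d`: every SHORT level row of `G`
  (`e_a + e_{a′} = ℓ + i`, inert degree `d − ℓ`, `1 ≤ i`, `3i ≤ ℓ ≤ d`) off the coset (`q ∤ A + i`, or an inert exponent
  prime to `q`) vanishes — via the kernel `…RowLemma.level_succ_le_three_mul_of_row_ne_zero`;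
* §3 **`row_eq_zero_of_pair_laws_step`** — sanity instance: the laws of two literal steps
  (`…LayerBirths.coeff_step_F_chartExponent`) give back the step form (cf. `row_eq_zero_of_loseBoth_satellite`).
[cite: Hauser2010, §I (definition of P⁺)] [cite: CossartJannsenSaito2020, Lemma 13.2, Thm. 13.7]
bears_on: LADDER-RESOLUTION:D157-DOOR2 (res-dim4-pi · K2(p) · K29a row lemma, coefficient-law form).  Supports
stmt-ResolutionOfSingularities-16155 (helper).
-/

set_option linter.dupNamespace false -- mandated namespace of this single-conjunct summit

noncomputable section

namespace Summit.ResolutionOfSingularities.ResolutionOfSingularities.Theorems.PIDim4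

namespace ResCone

open MvPolynomial Finset
open Literature.AlgebraicGeometry.Resolution
open Literature.AlgebraicGeometry.Resolution.CentreBlowup
open Literature.AlgebraicGeometry.Resolution.Hauser2010

variable {K : Type} [Field K]

/-! ## 1. (RL-b) for three polynomials -/

section Laws

/-- **(RL-b) TRANSPORT IN COEFFICIENT-LAW FORM** (any `q`, any field).  Three polynomials `F₀, F₁, F₂` in the letters
`a ≠ a′` + two inert ones, related by the chart-`a` law `hS1` and the chart-`a′` law `hS2` off the `q`-th-power lattice
(the shape `…LayerBirths.coeff_step_F_chartExponent` gives for literal steps and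
`…ResConeFrameConjugation.coeff_step_frame` for steps read in moving frames), `F₁` of order `≥ q`, `F₂` of order `≥ o₂`
with its degree-`o₂` monomials having `x_a`-exponent `A`.  Then a monomial `x^E` with `|E| > A + q`, off the coset
(`q ∤ |E| − q`, or an inert exponent prime to `q`) and `2|E| + E_{a′} + 2|E|_inert ≤ o₂ + 3q` is ABSENT from `F₀`.
[OURS] [cite: Hauser2010, §I (definition of P⁺)] -/
theorem coeff_eq_zero_of_pair_laws {q : ℕ} {a a' : Fin 4} (haa : a ≠ a') {F₀ F₁ F₂ : MvPolynomial (Fin 4) K}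
    (hS1 : ∀ e : Fin 4 →₀ ℕ, q ≤ e.degree → ¬ IsPthPowerExponent q (chartExponent q Finset.univ a e) →
      coeff (chartExponent q Finset.univ a e) F₁ = coeff e F₀)
    (hF₁ : ∀ e' ∈ F₁.support, q ≤ e'.degree)
    (hS2 : ∀ e' : Fin 4 →₀ ℕ, q ≤ e'.degree → ¬ IsPthPowerExponent q (chartExponent q Finset.univ a' e') →
      coeff (chartExponent q Finset.univ a' e') F₂ = coeff e' F₁)
    {o₂ A : ℕ} (hF₂ : ∀ M ∈ F₂.support, o₂ ≤ M.degree ∧ (M.degree = o₂ → M a = A))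
    {E : Fin 4 →₀ ℕ} (hA : A + q < E.degree)
    (hnc : ¬ q ∣ E.degree - q ∨ ∃ i, i ≠ a ∧ i ≠ a' ∧ ¬ q ∣ E i)
    (hlt : 2 * E.degree + E a' + 2 * degIn ((Finset.univ.erase a).erase a') E ≤ o₂ + 3 * q) :
    coeff E F₀ = 0 := by
  set P := (Finset.univ.erase a).erase a' with hP
  have hqE : q ≤ E.degree := by omega
  -- the first chart image
  set E₁ := chartExponent q Finset.univ a E with hE₁
  have hE₁a : E₁ a = E.degree - q := chartExponent_univ_apply_self q a E
  have hE₁i : ∀ i, i ≠ a → E₁ i = E i := fun i hi => chartExponent_apply_of_ne q Finset.univ hi E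
  have hE₁deg : E₁.degree + q + E a = 2 * E.degree := degree_chartExponent_univ q a hqE
  have hnp₁ : ¬ IsPthPowerExponent q E₁ := by
    rcases hnc with h | ⟨i, hia, -, hi⟩
    · exact not_isPthPowerExponent_of_not_dvd (i := a) (by rw [hE₁a]; exact h)
    · exact not_isPthPowerExponent_of_not_dvd (i := i) (by rw [hE₁i i hia]; exact hi)
  rw [← hS1 E hqE hnp₁]
  -- below the floor of `F₁` the image is absent anyway
  by_cases hqE₁ : q ≤ E₁.degree
  swap
  · by_contra hne
    exact hqE₁ (hF₁ E₁ (MvPolynomial.mem_support_iff.mpr hne))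
  -- the second chart image
  set E₂ := chartExponent q Finset.univ a' E₁ with hE₂
  have hE₂a : E₂ a = E.degree - q := by
    rw [hE₂, chartExponent_apply_of_ne q Finset.univ haa E₁, hE₁a]
  have hE₂i : ∀ i, i ≠ a' → E₂ i = E₁ i := fun i hi => chartExponent_apply_of_ne q Finset.univ hi E₁
  have hE₂deg : E₂.degree + q + E₁ a' = 2 * E₁.degree := degree_chartExponent_univ q a' hqE₁
  have hnp₂ : ¬ IsPthPowerExponent q E₂ := by
    rcases hnc with h | ⟨i, hia, hia', hi⟩
    · exact not_isPthPowerExponent_of_not_dvd (i := a) (by rw [hE₂a]; exact h)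
    · exact not_isPthPowerExponent_of_not_dvd (i := i) (by rw [hE₂i i hia', hE₁i i hia]; exact hi)
  rw [← hS2 E₁ hqE₁ hnp₂]
  by_contra hne
  have hmem : E₂ ∈ F₂.support := MvPolynomial.mem_support_iff.mpr hne
  obtain ⟨hge, htop⟩ := hF₂ E₂ hmem
  have hsplit := degree_eq_apply_add_apply_add_degIn haa E
  rw [← hP] at hsplit
  have hE₁a' : E₁ a' = E a' := hE₁i a' haa.symm
  have heq : E₂.degree = o₂ := by omega
  have hEa := htop heq
  rw [hE₂a] at hEa
  omega

end Laws

/-! ## 2. (RL) in coefficient-law form -/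

section Row

/-- **(RL) THE ROW LEMMA IN COEFFICIENT-LAW FORM** (any `q`, any field).  Let `F₀ = shear_a^{t e_{a′}} (x_a^α
x_{a′}^β · G)` with `t ≠ 0` (the sheared parent of a lose-both step with boundary `x_a^α x_{a′}^β`; in a moving frame,
`G` is the RE-COORDINATISED residual polynomial), and let `F₁, F₂` obey the laws of `coeff_eq_zero_of_pair_laws` with
the H-tail numerology `A + q = α + β + d` (new weight `A = r_V`) and `o₂ + 3q = 2(α + β) + 4d` (shade `d` at the three
states).  Then every SHORT level row of `G` — exponents `e` with `e_a + e_{a′} = ℓ + i`, inert degree `d − ℓ`, `1 ≤ i`,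
`3i ≤ ℓ ≤ d` — off the coset (`q ∤ A + i`, or an inert exponent prime to `q`) VANISHES: idea-4's `R^{(ℓ)}_{ℓ+i} = 0`,
`1 ≤ i ≤ ⌊ℓ/3⌋`.  (§1 supplies the S-legality hypothesis `e_{a′} < 2ℓ + 1 − 2i` of the kernel
`level_succ_le_three_mul_of_row_ne_zero`, whose conclusion `ℓ + 1 ≤ 3i` is absurd.) [OURS]
[cite: Hauser2010, §I (definition of P⁺)] [cite: CossartJannsenSaito2020, Lemma 13.2, Thm. 13.7] -/
theorem row_eq_zero_of_pair_laws {q : ℕ} {a a' : Fin 4} (haa : a ≠ a') {t : K} (ht : t ≠ 0)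
    {α β d A o₂ : ℕ} (hAq : A + q = α + β + d) (hnum : o₂ + 3 * q = 2 * (α + β) + 4 * d)
    (G F₁ F₂ : MvPolynomial (Fin 4) K)
    (hS1 : ∀ e : Fin 4 →₀ ℕ, q ≤ e.degree → ¬ IsPthPowerExponent q (chartExponent q Finset.univ a e) →
      coeff (chartExponent q Finset.univ a e) F₁ = coeff e (shear a (Pi.single a' t)
        (monomial (Finsupp.single a α + Finsupp.single a' β) (1 : K) * G)))
    (hF₁ : ∀ e' ∈ F₁.support, q ≤ e'.degree)
    (hS2 : ∀ e' : Fin 4 →₀ ℕ, q ≤ e'.degree → ¬ IsPthPowerExponent q (chartExponent q Finset.univ a' e') →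
      coeff (chartExponent q Finset.univ a' e') F₂ = coeff e' F₁)
    (hF₂ : ∀ M ∈ F₂.support, o₂ ≤ M.degree ∧ (M.degree = o₂ → M a = A))
    {ℓ i : ℕ} (hℓ : ℓ ≤ d) (hi₁ : 1 ≤ i) (hi : 3 * i ≤ ℓ)
    {e₀ : Fin 4 →₀ ℕ} (he₀ : e₀ a + e₀ a' = ℓ + i)
    (hκ₀ : degIn ((Finset.univ.erase a).erase a') e₀ = d - ℓ)
    (hnc : ¬ q ∣ A + i ∨ ∃ i', i' ≠ a ∧ i' ≠ a' ∧ ¬ q ∣ e₀ i') :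
    coeff e₀ G = 0 := by
  set P := (Finset.univ.erase a).erase a' with hP
  by_contra hne
  have key := level_succ_le_three_mul_of_row_ne_zero haa ht α β G ℓ i (fun i' => e₀ i')
    ?_ he₀ (fun _ _ _ => rfl) hne
  · omega
  -- S-legality on the row, from §1
  intro e hD hκ hN
  have hκe : degIn P e = degIn P e₀ := Finset.sum_congr rfl fun i' hi' =>
    hκ i' (Finset.ne_of_mem_erase (Finset.mem_of_mem_erase hi')) (Finset.ne_of_mem_erase hi')
  have hdege : e.degree = ℓ + i + (d - ℓ) := by
    rw [degree_eq_apply_add_apply_add_degIn haa e, ← hP, hκe, hκ₀, hD]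
  have hdegE : (e + Finsupp.single a (α + β)).degree = α + β + d + i := by
    rw [map_add, Finsupp.degree_single, hdege]; omega
  have hEa' : (e + Finsupp.single a (α + β)) a' = e a' := by
    rw [Finsupp.add_apply, Finsupp.single_eq_of_ne haa.symm, add_zero]
  have hPE : degIn P (e + Finsupp.single a (α + β)) = d - ℓ := by
    rw [degIn_add, hP, degIn_single_of_not_mem (not_mem_passive_left a a'), add_zero, ← hP, hκe, hκ₀]
  refine coeff_eq_zero_of_pair_laws haa hS1 hF₁ hS2 hF₂ (by omega) ?_ ?_
  · rcases hnc with h | ⟨i', hia, hia', hi'⟩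
    · left
      rw [hdegE, show α + β + d + i - q = A + i by omega]
      exact h
    · right
      refine ⟨i', hia, hia', ?_⟩
      rw [Finsupp.add_apply, Finsupp.single_eq_of_ne hia, add_zero, hκ i' hia hia']
      exact hi'
  · rw [hdegE, hEa', ← hP, hPE]
    omega

end Row

/-! ## 3. Sanity instance: two literal steps -/

section StepInstance

variable [DecidableEq K]

/-- **The step form is an instance of the law form**: for `s₁ = step_a^{t e_{a′}} s₀`, `s₂ = step_{a′}^0 s₁` (both
parents of order `≥ q` along the point), the laws `hS1`, `hS2` are `…LayerBirths.coeff_step_F_chartExponent`, so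
`row_eq_zero_of_pair_laws` gives back the step dress of `…ResConeRowLemmaChain` (stated here with the abstract
numerology `A + q = α + β + d`, `o₂ + 3q = 2(α + β) + 4d` and `hF₂` on the grandchild). [OURS]
[cite: Hauser2010, §I (definition of P⁺)] -/
theorem row_eq_zero_of_pair_laws_step {q : ℕ} {a a' : Fin 4} (haa : a ≠ a') {t : K} (ht : t ≠ 0)
    {s₀ s₁ s₂ : State K} (hs₁ : s₁ = CentreBlowup.step q Finset.univ a (Pi.single a' t) s₀)
    (hs₂ : s₂ = CentreBlowup.step q Finset.univ a' 0 s₁)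
    (hq₀ : (q : ℕ∞) ≤ ordAlong Finset.univ s₀.F) (hq₁ : (q : ℕ∞) ≤ ordAlong Finset.univ s₁.F)
    {α β d A o₂ : ℕ} (hAq : A + q = α + β + d) (hnum : o₂ + 3 * q = 2 * (α + β) + 4 * d)
    (hr₀ : s₀.r = Finsupp.single a α + Finsupp.single a' β) (hrle : ∀ m ∈ s₀.F.support, s₀.r ≤ m)
    (hF₂ : ∀ M ∈ s₂.F.support, o₂ ≤ M.degree ∧ (M.degree = o₂ → M a = A))
    {ℓ i : ℕ} (hℓ : ℓ ≤ d) (hi₁ : 1 ≤ i) (hi : 3 * i ≤ ℓ)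
    {e₀ : Fin 4 →₀ ℕ} (he₀ : e₀ a + e₀ a' = ℓ + i)
    (hκ₀ : degIn ((Finset.univ.erase a).erase a') e₀ = d - ℓ)
    (hnc : ¬ q ∣ A + i ∨ ∃ i', i' ≠ a ∧ i' ≠ a' ∧ ¬ q ∣ e₀ i') :
    coeff (s₀.r + e₀) s₀.F = 0 := by
  have hta : (Pi.single a' t : Fin 4 → K) a = 0 := by rw [Pi.single_eq_of_ne haa]
  have hFG : monomial (Finsupp.single a α + Finsupp.single a' β) (1 : K) * s₀.F.divMonomial s₀.r = s₀.F := by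
    rw [← hr₀]; exact (eq_monomial_mul_divMonomial hrle).symm
  have h := row_eq_zero_of_pair_laws haa ht hAq hnum (s₀.F.divMonomial s₀.r) s₁.F s₂.F
    (fun e he hnp => by rw [hFG, hs₁, coeff_step_F_chartExponent q a hta s₀ hq₀ he, if_neg hnp])
    (fun e' he' => le_degree_of_mem_support hq₁ he')
    (fun e' he' hnp => by
      rw [hs₂, coeff_step_F_chartExponent q a' rfl s₁ hq₁ he', if_neg hnp, shear_zero])
    hF₂ hℓ hi₁ hi he₀ hκ₀ hnc
  rw [coeff_divMonomial_pair] at h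
  exact h

end StepInstance

end ResCone

end Summit.ResolutionOfSingularities.ResolutionOfSingularities.Theorems.PIDim4

end
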